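import Literature.Combinatorics.Optimization.CutPolytopeMinorMonotone
import Literature.Combinatorics.Optimization.PolytopePsdRankLowerBound
import Literature.Combinatorics.Optimization.PsdLiftSlackMatrix
import Literature.Combinatorics.Optimization.PsdRankComparisons
import HarnessLib

/-!
# The Lovász theta body as a psd lift of size `n + 1` of the stable set polytope, and the odd-hole
# obstruction (Gouveia–Robinson–Thomas 2013, §4, Theorem 4.12) — PROVED parts

Source: J. Gouveia, R. Z. Robinson, R. R. Thomas, *Polytopes of minimum positive semidefinite rank*,
Discrete Comput. Geom. 50 (2013) 679–699 = arXiv:1205.5306 [GouveiaRobinsonThomas2013], end of §4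
(held text `paper:arxiv-1205.5306`, chunks p13–p14); L. Lovász, *On the Shannon capacity of a
graph* (1979) [Lovasz1979] for `TH(G)`.

The printed text (p13, verbatim). "Let `G = ([n],E)` be a graph … The stable set polytope of `G` is
the `n`-dimensional polytope `STAB(G) := convex hull(χ^S : S stable set in G) ⊂ ℝⁿ`, and `TH(G)` is
the following projection of an affine slice of `S^{n+1}_+`:
`{x ∈ ℝⁿ : ∃ [[1, xᵀ],[x, U]] ⪰ 0 s.t. U_ii = x_i ∀ i = 1,…,n and U_ij = 0 ∀ {i,j} ∈ E}`.
Further, `TH(G) = STAB(G)` if and only if `G` is a perfect graph [GLS]. Hence if `G` is perfect,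
`rank_psd STAB(G) = n+1` and the description of `TH(G)` gives a `S^{n+1}_+`-lift of `STAB(G)`. …
**Theorem 4.12.** Let `G` be a graph with `n` vertices. Then `STAB(G)` has psd rank `n+1` if and only
if `G` is perfect." The printed proof of "only if" (p13–p14): a non-perfect `G` contains an odd hole
or odd antihole `H` (strong perfect graph theorem); `STAB(H)` is a face of `STAB(G)`; for the odd
hole `H = C_{2m+1}` the `(2m+3) × (2m+3)` submatrix `S'` of the slack matrix of `STAB(H)` on the
stable sets `∅,{1},…,{2m+1},{1,3}` and the facets `x₁+x₂ ≤ 1, x₁ ≥ 0,…,x_{2m+1} ≥ 0, Σx ≤ m`,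
`S' = [[1,0,…,0,m],[0,1,0,…,0,m−1],[0,0,1,0,…,m−1],[1,0,0,1,…,m−1],…,[1,0,…,0,1,m−1],
[0,1,0,1,0,…,0,m−2]]`, has every Hadamard square root of rank `> 2m+2` ("by looking at the first,
second, fourth, and last columns … `±α₂ ± α₄ = ±√(m−2)`, which is a contradiction"), "Hence
`rank_√ S' > 2m+2` and we have that `STAB(H)` is not of minimal psd rank." ("The anti-hole case is
exactly analogous and is omitted here.")

What is PROVED here (stable sets, `stableSetVector`, `stabPolytope G = conv{χ^S}` are the tree's,
`CutTspStabPsdRank.lean` / `CutPolytopeMinorMonotone.lean`; psd lifts are the tree's `HasPsdLift`,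
`PsdLiftSlackMatrix.lean`):

| claim | Lean | status |
|---|---|---|
| `TH(G)` (the displayed set) | `lovaszThetaBody` | DEFINED |
| "`TH(G)` is [a] projection of an affine slice of `S^{n+1}_+`" | `hasPsdLift_lovaszThetaBody` | PROVED |
| `STAB(G) ⊆ TH(G)` ("a convex relaxation of the stable set polytope") | `convex_lovaszThetaBody`, `stableSetVector_mem_lovaszThetaBody`, `stabPolytope_subset_lovaszThetaBody` | PROVED |
| `TH(G) ⊆ QSTAB(G) = {x ≥ 0 : x(K) ≤ 1 ∀ cliques K}` (Lovász) | `cliqueConstraintPolytope`, `lovaszThetaBody_subset_cliqueConstraintPolytope` | PROVED |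
| "if `G` is perfect … the description of `TH(G)` gives a `S^{n+1}_+`-lift of `STAB(G)`", typed with perfection replaced by its polyhedral characterisation `STAB(G) = QSTAB(G)` (Chvátal 1975 / Lovász 1972, not typed) | `lovaszThetaBody_eq_stabPolytope`, **`hasPsdLift_stabPolytope_of_eq_cliqueConstraintPolytope`** | PROVED |
| "… `rank_psd STAB(G) = n+1`": no psd lift of `STAB(G)` is smaller than `n + 1` (GRT Prop. 3.2, via the tree's FGPRT Thm 3.3 bridge and `add_one_le_of_hasPsdFactorization_slack`) | **`add_one_le_of_hasPsdLift_stabPolytope`** | PROVED |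
| the odd-hole matrix `S'` (any vertex type `V`, vertices `p,q,r`, parameter `m`) and "`rank_√ S' > 2m+2`": EVERY Hadamard square root of `S'` is nonsingular | `oddHoleMatrix`, `oddHoleMatrix_eq_slack`, `mulVec_eq_zero_of_sq_eq_oddHoleMatrix`, **`rank_eq_of_sq_eq_oddHoleMatrix`**, `not_hasHadamardSqrtOfRankLE_oddHoleMatrix` | PROVED (sign-free: `μt = 0`, `t² + μ² = 0`) |
| (appended) the same computation for a CLIQUE column `x(K) ≤ 1`, `p ∈ K ∌ r`, any real `m` — which is what the printed argument uses — covering "The anti-hole case is exactly analogous and is omitted here" (odd antihole: `K` a maximum clique, `{p,r}` a stable pair, `m = α = 2`): every Hadamard square root of the clique-column pattern is nonsingular | `cliqueRankObstructionMatrix`, `cliqueRankObstructionMatrix_eq_slack`, `oddHoleMatrix_eq_cliqueRankObstructionMatrix`, **`mulVec_eq_zero_of_sq_eq_cliqueRankObstructionMatrix`**, `rank_eq_of_sq_eq_cliqueRankObstructionMatrix`, `not_hasHadamardSqrtOfRankLE_cliqueRankObstructionMatrix` | PROVED |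

NOT typed: perfect graphs and the equivalence "`TH(G) = STAB(G)` iff `G` perfect" [GLS] / Chvátal's
`STAB = QSTAB` characterisation; the strong perfect graph theorem step, the face argument
(GRT's "Proposition (face psd rank)") and the graph-theoretic framing of the hole/antihole
submatrices (that the rows are stable sets and the columns facets of `STAB(H)`) — so Theorem 4.12
itself is not asserted here; what is typed is its displayed mechanism in both directions, the
antihole computation included.
-/

noncomputable section

open Matrix Finset
open scoped MatrixOrder

namespace Literature.Combinatorics.Optimization

variable {n : ℕ}

/-! ### The theta body -/

/-- **`QSTAB(G)`**, the clique-constraint relaxation `{x ≥ 0 : Σ_{i∈K} x_i ≤ 1 for every clique K}`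
of the stable set polytope (Lovász: `STAB ⊆ TH ⊆ QSTAB`). [cite: Lovasz1979, §III; GouveiaRobinsonThomas2013, §4 (p13)] -/
def cliqueConstraintPolytope (G : SimpleGraph (Fin n)) : Set (Fin n → ℝ) :=
  {x | (∀ i, 0 ≤ x i) ∧ ∀ K : Finset (Fin n), G.IsClique (K : Set (Fin n)) → ∑ i ∈ K, x i ≤ 1}

/-- **The Lovász theta body `TH(G)`** (GRT p13, verbatim display): the `x ∈ ℝⁿ` for which some
`Y = [[1, xᵀ],[x, U]] ∈ S^{n+1}_+` has `U_ii = x_i` for all `i` and `U_ij = 0` for all edges `{i,j}`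
(index `0` is the homogenising coordinate, `i.succ` the vertex `i`).
[cite: GouveiaRobinsonThomas2013, §4 (p13); Lovasz1979, §III] -/
def lovaszThetaBody (G : SimpleGraph (Fin n)) : Set (Fin n → ℝ) :=
  {x | ∃ Y : Matrix (Fin (n + 1)) (Fin (n + 1)) ℝ, Y.PosSemidef ∧ Y 0 0 = 1 ∧
    (∀ i, Y 0 i.succ = x i) ∧ (∀ i, Y i.succ i.succ = x i) ∧ ∀ i j, G.Adj i j → Y i.succ j.succ = 0}

/-- The direction of the affine slice defining `TH(G)`: matrices with `Y₀₀ = 0`, `Y₀ᵢ = Yᵢᵢ`,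
`Y_ij = 0` on edges. [cite: GouveiaRobinsonThomas2013, §4 (p13)] -/
def thetaDirection (G : SimpleGraph (Fin n)) : Submodule ℝ (Matrix (Fin (n + 1)) (Fin (n + 1)) ℝ) where
  carrier := {Y | Y 0 0 = 0 ∧ (∀ i : Fin n, Y 0 i.succ = Y i.succ i.succ) ∧
    ∀ i j : Fin n, G.Adj i j → Y i.succ j.succ = 0}
  add_mem' := by
    rintro A B ⟨hA0, hA1, hA2⟩ ⟨hB0, hB1, hB2⟩
    exact ⟨by simp [hA0, hB0], fun i => by simp [hA1 i, hB1 i],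
      fun i j hij => by simp [hA2 i j hij, hB2 i j hij]⟩
  zero_mem' := by simp
  smul_mem' := by
    rintro c A ⟨h0, h1, h2⟩
    exact ⟨by simp [h0], fun i => by simp [h1 i], fun i j hij => by simp [h2 i j hij]⟩

/-- The base point `E₀₀` of the affine slice. [cite: GouveiaRobinsonThomas2013, §4 (p13)] -/
def thetaBase (n : ℕ) : Matrix (Fin (n + 1)) (Fin (n + 1)) ℝ :=
  Matrix.of fun p q => if p = 0 ∧ q = 0 then 1 else 0

/-- The affine slice `L = {Y : Y₀₀ = 1, Y₀ᵢ = Yᵢᵢ, Y_ij = 0 on edges}`.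
[cite: GouveiaRobinsonThomas2013, §4 (p13)] -/
def thetaSlice (G : SimpleGraph (Fin n)) : AffineSubspace ℝ (Matrix (Fin (n + 1)) (Fin (n + 1)) ℝ) :=
  AffineSubspace.mk' (thetaBase n) (thetaDirection G)

/-- Membership in the direction. [cite: GouveiaRobinsonThomas2013, §4 (p13)] -/
theorem mem_thetaDirection_iff (G : SimpleGraph (Fin n)) (Y : Matrix (Fin (n + 1)) (Fin (n + 1)) ℝ) :
    Y ∈ thetaDirection G ↔
      Y 0 0 = 0 ∧ (∀ i : Fin n, Y 0 i.succ = Y i.succ i.succ) ∧ ∀ i j : Fin n, G.Adj i j → Y i.succ j.succ = 0 :=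
  Iff.rfl

/-- Membership in the affine slice. [cite: GouveiaRobinsonThomas2013, §4 (p13)] -/
theorem mem_thetaSlice_iff (G : SimpleGraph (Fin n)) (Y : Matrix (Fin (n + 1)) (Fin (n + 1)) ℝ) :
    Y ∈ thetaSlice G ↔
      Y 0 0 = 1 ∧ (∀ i : Fin n, Y 0 i.succ = Y i.succ i.succ) ∧ ∀ i j : Fin n, G.Adj i j → Y i.succ j.succ = 0 := by
  rw [thetaSlice, AffineSubspace.mem_mk', vsub_eq_sub, mem_thetaDirection_iff]
  simp [thetaBase, Matrix.sub_apply, Fin.succ_ne_zero, sub_eq_zero]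

/-- The projection `Y ↦ (Y₀ᵢ)_{i}`. [cite: GouveiaRobinsonThomas2013, §4 (p13)] -/
def thetaProj (n : ℕ) : Matrix (Fin (n + 1)) (Fin (n + 1)) ℝ →ₗ[ℝ] (Fin n → ℝ) where
  toFun Y i := Y 0 i.succ
  map_add' _ _ := rfl
  map_smul' _ _ := rfl

/-- **"`TH(G)` is the following projection of an affine slice of `S^{n+1}_+`"**: `TH(G)` has a psd lift
of size `n + 1` in the sense of the tree's `HasPsdLift` (FGPRT §3.1).
[cite: GouveiaRobinsonThomas2013, §4 (p13)] -/
theorem hasPsdLift_lovaszThetaBody (G : SimpleGraph (Fin n)) : HasPsdLift (lovaszThetaBody G) (n + 1) := by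
  refine ⟨thetaSlice G, thetaProj n, ?_⟩
  ext x
  constructor
  · rintro ⟨Y, hY, h0, h1, h2, h3⟩
    refine ⟨Y, ⟨hY, (mem_thetaSlice_iff G Y).mpr ⟨h0, fun i => (h1 i).trans (h2 i).symm, h3⟩⟩, ?_⟩
    funext i
    exact h1 i
  · rintro ⟨Y, ⟨hY, hL⟩, rfl⟩
    obtain ⟨h0, h1, h3⟩ := (mem_thetaSlice_iff G Y).mp hL
    exact ⟨Y, hY, h0, fun i => rfl, fun i => (h1 i).symm, h3⟩

/-- `TH(G)` is convex. [cite: GouveiaRobinsonThomas2013, §4 (p13: "a convex relaxation")] -/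
theorem convex_lovaszThetaBody (G : SimpleGraph (Fin n)) : Convex ℝ (lovaszThetaBody G) := by
  intro x hx y hy a b ha hb hab
  obtain ⟨Y, hY, hY0, hY1, hY2, hY3⟩ := hx
  obtain ⟨Z, hZ, hZ0, hZ1, hZ2, hZ3⟩ := hy
  refine ⟨a • Y + b • Z, (hY.smul ha).add (hZ.smul hb), ?_, fun i => ?_, fun i => ?_, fun i j hij => ?_⟩
  · simp [hY0, hZ0, hab]
  · simp [hY1, hZ1]
  · simp [hY2, hZ2]
  · simp [hY3 i j hij, hZ3 i j hij]

/-- Every vertex `χ^S` of `STAB(G)` lies in `TH(G)`: `Y = (1,χ^S)(1,χ^S)ᵀ`.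
[cite: GouveiaRobinsonThomas2013, §4 (p13); Lovasz1979, §III] -/
theorem stableSetVector_mem_lovaszThetaBody {G : SimpleGraph (Fin n)} (S : StableSets G) :
    stableSetVector S ∈ lovaszThetaBody G := by
  let v : Fin (n + 1) → ℝ := Fin.cons 1 (stableSetVector S)
  have hx01 : ∀ i, stableSetVector S i * stableSetVector S i = stableSetVector S i := fun i => by
    unfold stableSetVector; split_ifs <;> simp
  refine ⟨vecMulVec v v, by simpa using posSemidef_vecMulVec_self_star v, ?_, fun i => ?_, fun i => ?_,
    fun i j hij => ?_⟩
  · simp [vecMulVec_apply, v]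
  · simp [vecMulVec_apply, v]
  · simp [vecMulVec_apply, v, hx01 i]
  · simp only [vecMulVec_apply, v, Fin.cons_succ, stableSetVector]
    have : ¬ (i ∈ S.1 ∧ j ∈ S.1) := fun h => S.2 i h.1 j h.2 hij
    by_cases hi : i ∈ S.1
    · have hj : j ∉ S.1 := fun hj => this ⟨hi, hj⟩
      simp [hi, hj]
    · simp [hi]

/-- **`STAB(G) ⊆ TH(G)`** ("a convex relaxation of the stable set polytope").
[cite: GouveiaRobinsonThomas2013, §4 (p13)] -/
theorem stabPolytope_subset_lovaszThetaBody (G : SimpleGraph (Fin n)) :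
    stabPolytope G ⊆ lovaszThetaBody G :=
  convexHull_min (by rintro _ ⟨S, rfl⟩; exact stableSetVector_mem_lovaszThetaBody S)
    (convex_lovaszThetaBody G)

/-- The quadratic form of `Y` at `(1, w)`: `Y₀₀ + Σᵢ Y₀ᵢwᵢ + Σᵢ wᵢYᵢ₀ + Σᵢⱼ wᵢYᵢⱼwⱼ`. [folklore] -/
private theorem dotProduct_mulVec_cons_one (Y : Matrix (Fin (n + 1)) (Fin (n + 1)) ℝ) (w : Fin n → ℝ) :
    (Fin.cons 1 w : Fin (n + 1) → ℝ) ⬝ᵥ (Y *ᵥ (Fin.cons 1 w : Fin (n + 1) → ℝ)) =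
      Y 0 0 + ∑ j, Y 0 j.succ * w j + ∑ i, w i * Y i.succ 0 +
        ∑ i, ∑ j, w i * (Y i.succ j.succ * w j) := by
  simp only [dotProduct, mulVec, Fin.sum_univ_succ, Fin.cons_zero, Fin.cons_succ, one_mul, mul_one,
    mul_add, Finset.mul_sum, Finset.sum_add_distrib]
  ring

/-- **`TH(G) ⊆ QSTAB(G)`** (Lovász): for `x ∈ TH(G)` with certificate `Y`, `x_i = Y_ii ≥ 0`, and for a
clique `K`, with `u = (1, −χ^K)`: `0 ≤ uᵀYu = 1 − 2x(K) + Σ_{i,j∈K} Y_ij = 1 − x(K)` (off-diagonal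
entries inside a clique are edge entries, hence `0`). [cite: Lovasz1979, §III; GouveiaRobinsonThomas2013, §4 (p13)] -/
theorem lovaszThetaBody_subset_cliqueConstraintPolytope (G : SimpleGraph (Fin n)) :
    lovaszThetaBody G ⊆ cliqueConstraintPolytope G := by
  classical
  rintro x ⟨Y, hY, hY0, hY1, hY2, hY3⟩
  have hsymm : ∀ p q, Y p q = Y q p := fun p q => by
    simpa using (hY.1.apply p q).symm
  refine ⟨fun i => by rw [← hY2 i]; exact hY.diag_nonneg, fun K hK => ?_⟩
  -- the test vector `u = (1, −χ^K)`
  let w : Fin n → ℝ := fun i => if i ∈ K then -1 else 0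
  have hq := hY.dotProduct_mulVec_nonneg (Fin.cons 1 w : Fin (n + 1) → ℝ)
  rw [star_trivial, dotProduct_mulVec_cons_one] at hq
  -- evaluate the four pieces
  have h1 : ∑ j, Y 0 j.succ * w j = -∑ i ∈ K, x i := by
    simp only [w, mul_ite, mul_neg, mul_one, mul_zero]
    rw [Fintype.sum_ite_mem, Finset.sum_neg_distrib]
    exact congrArg Neg.neg (Finset.sum_congr rfl fun i _ => hY1 i)
  have h2 : ∑ i, w i * Y i.succ 0 = -∑ i ∈ K, x i := by
    simp only [w, ite_mul, neg_mul, one_mul, zero_mul]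
    rw [Fintype.sum_ite_mem, Finset.sum_neg_distrib]
    exact congrArg Neg.neg (Finset.sum_congr rfl fun i _ => by rw [hsymm, hY1])
  have h3 : ∑ i, ∑ j, w i * (Y i.succ j.succ * w j) = ∑ i ∈ K, x i := by
    have inner : ∀ i : Fin n, ∑ j, Y i.succ j.succ * w j = -∑ j ∈ K, Y i.succ j.succ := fun i => by
      simp only [w, mul_ite, mul_neg, mul_one, mul_zero]
      rw [Fintype.sum_ite_mem, Finset.sum_neg_distrib]
    have houter : ∑ i, w i * (∑ j, Y i.succ j.succ * w j) = ∑ i ∈ K, ∑ j ∈ K, Y i.succ j.succ := by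
      simp only [inner, w, ite_mul, neg_mul, one_mul, zero_mul, neg_neg]
      rw [Fintype.sum_ite_mem]
    have hK' : ∀ i ∈ K, ∑ j ∈ K, Y i.succ j.succ = x i := by
      intro i hi
      rw [Finset.sum_eq_single_of_mem i hi (fun j hj hji => hY3 i j (hK hi hj (Ne.symm hji)))]
      exact hY2 i
    calc ∑ i, ∑ j, w i * (Y i.succ j.succ * w j)
        = ∑ i, w i * (∑ j, Y i.succ j.succ * w j) := by
          refine Finset.sum_congr rfl fun i _ => ?_; rw [Finset.mul_sum]
      _ = ∑ i ∈ K, ∑ j ∈ K, Y i.succ j.succ := houter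
      _ = ∑ i ∈ K, x i := Finset.sum_congr rfl hK'
  rw [hY0, h1, h2, h3] at hq
  linarith

/-- **`TH(G) = STAB(G)` when `STAB(G) = QSTAB(G)`** (for perfect `G`: Lovász / Chvátal, GRT "Further,
`TH(G) = STAB(G)` if and only if `G` is a perfect graph [GLS]" — the hypothesis is perfection in its
polyhedral form). [cite: GouveiaRobinsonThomas2013, §4 (p13); Lovasz1979, §III] -/
theorem lovaszThetaBody_eq_stabPolytope {G : SimpleGraph (Fin n)}
    (h : stabPolytope G = cliqueConstraintPolytope G) : lovaszThetaBody G = stabPolytope G :=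
  Set.Subset.antisymm (h ▸ lovaszThetaBody_subset_cliqueConstraintPolytope G)
    (stabPolytope_subset_lovaszThetaBody G)

/-- **GRT §4 / Theorem 4.12 ⇐, the lift**: "if `G` is perfect, … the description of `TH(G)` gives a
`S^{n+1}_+`-lift of `STAB(G)`" — typed with perfection in its polyhedral form `STAB(G) = QSTAB(G)`:
then `STAB(G)` has a psd lift of size `n + 1`. [cite: GouveiaRobinsonThomas2013, Thm. 4.12 (p13)] -/
theorem hasPsdLift_stabPolytope_of_eq_cliqueConstraintPolytope {G : SimpleGraph (Fin n)}
    (h : stabPolytope G = cliqueConstraintPolytope G) : HasPsdLift (stabPolytope G) (n + 1) := by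
  rw [← lovaszThetaBody_eq_stabPolytope h]
  exact hasPsdLift_lovaszThetaBody G


/-! ### The matching lower bound `n + 1` (GRT Prop. 3.2 through FGPRT Thm 3.3) -/

/-- The stable-set vectors of an `n`-vertex graph, `n ≥ 1`, affinely span `ℝⁿ` (`χ^{{i}} − χ^∅ = e_i`).
[cite: GouveiaRobinsonThomas2013, §4 (p13: "the `n`-dimensional polytope `STAB(G)`")] -/
theorem vectorSpan_stableSetVector_eq_top (G : SimpleGraph (Fin n)) :
    vectorSpan ℝ (Set.range (stableSetVector (G := G))) = ⊤ := by
  classical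
  refine top_le_iff.mp ?_
  rw [← (Pi.basisFun ℝ (Fin n)).span_eq]
  refine Submodule.span_le.mpr ?_
  rintro _ ⟨i, rfl⟩
  have hempty : ∀ a ∈ (∅ : Finset (Fin n)), ∀ b ∈ (∅ : Finset (Fin n)), ¬ G.Adj a b := by simp
  have hsing : ∀ a ∈ ({i} : Finset (Fin n)), ∀ b ∈ ({i} : Finset (Fin n)), ¬ G.Adj a b := by simp
  have : (Pi.basisFun ℝ (Fin n) i : Fin n → ℝ) =
      stableSetVector (⟨{i}, hsing⟩ : StableSets G) -ᵥ stableSetVector (⟨∅, hempty⟩ : StableSets G) := by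
    ext j
    simp [stableSetVector, Pi.basisFun_apply, Pi.single_apply, eq_comm]
  rw [this]
  exact vsub_mem_vectorSpan ℝ ⟨_, rfl⟩ ⟨_, rfl⟩

/-- **GRT §4 / Thm 4.12 ⇐, "`rank_psd STAB(G) = n+1`" — the lower bound**: when
`STAB(G) = QSTAB(G)` (`G` perfect, polyhedral form) and `n ≥ 1`, every psd lift of `STAB(G)` has
size `≥ n + 1` (GRT Prop. 3.2 `rank_psd P ≥ dim P + 1`, obtained from the tree's FGPRT Thm 3.3
bridge `HasPsdLift.hasPsdFactorization_pairSlackMatrix` — the `H`-description of `STAB(G)` being the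
clique and nonnegativity inequalities — and `add_one_le_of_hasPsdFactorization_slack`); with
`hasPsdLift_stabPolytope_of_eq_cliqueConstraintPolytope` this is "`rank_psd STAB(G) = n+1`".
[cite: GouveiaRobinsonThomas2013, Thm. 4.12 (p13) with Prop. 3.2 (p07)] -/
theorem add_one_le_of_hasPsdLift_stabPolytope {G : SimpleGraph (Fin n)} (hn : 1 ≤ n)
    (h : stabPolytope G = cliqueConstraintPolytope G) {k : ℕ} (hk : HasPsdLift (stabPolytope G) k) :
    n + 1 ≤ k := by
  classical
  haveI : Fintype (StableSets G) := by unfold StableSets; infer_instance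
  have hempty : ∀ a ∈ (∅ : Finset (Fin n)), ∀ b ∈ (∅ : Finset (Fin n)), ¬ G.Adj a b := by simp
  rcases Nat.eq_zero_or_pos k with rfl | hk1
  · -- a lift of size `0` makes `STAB(G)` a point, but `χ^∅ ≠ χ^{{0}}`
    exfalso
    obtain ⟨L, π, hC⟩ := hk
    have hsub : (stabPolytope G).Subsingleton := by
      rw [hC]; exact Set.subsingleton_of_subsingleton.image _
    have hsing : ∀ a ∈ ({(⟨0, hn⟩ : Fin n)} : Finset (Fin n)), ∀ b ∈ ({(⟨0, hn⟩ : Fin n)} : Finset (Fin n)),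
        ¬ G.Adj a b := by simp
    have := congrFun (hsub (stableSetVector_mem_stabPolytope (⟨∅, hempty⟩ : StableSets G))
      (stableSetVector_mem_stabPolytope (⟨{⟨0, hn⟩}, hsing⟩ : StableSets G))) ⟨0, hn⟩
    simp [stableSetVector] at this
  · -- enumerate vertices and the `H`-description by `Fin`
    let CL := {K : Finset (Fin n) // G.IsClique (K : Set (Fin n))}
    let eS := Fintype.equivFin (StableSets G)
    let eI := Fintype.equivFin (Fin n ⊕ CL)
    let x : Fin (Fintype.card (StableSets G)) → (Fin n → ℝ) := fun t => stableSetVector (eS.symm t)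
    let a : Fin (Fintype.card (Fin n ⊕ CL)) → (Fin n → ℝ) := fun t =>
      Sum.elim (fun i => -(Pi.single i 1 : Fin n → ℝ)) (fun K => fun i => if i ∈ K.1 then (1 : ℝ) else 0)
        (eI.symm t)
    let b : Fin (Fintype.card (Fin n ⊕ CL)) → ℝ := fun t => Sum.elim (fun _ => (0 : ℝ)) (fun _ => 1) (eI.symm t)
    -- the inequality system is `QSTAB(G)`
    have hQ : {y : Fin n → ℝ | ∀ t, a t ⬝ᵥ y ≤ b t} = cliqueConstraintPolytope G := by
      ext y
      simp only [Set.mem_setOf_eq, cliqueConstraintPolytope]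
      constructor
      · intro hy
        refine ⟨fun i => ?_, fun K hK => ?_⟩
        · have := hy (eI (Sum.inl i))
          simp only [a, b, Equiv.symm_apply_apply, Sum.elim_inl, neg_dotProduct, single_dotProduct,
            one_mul] at this
          linarith
        · have := hy (eI (Sum.inr ⟨K, hK⟩))
          simp only [a, b, Equiv.symm_apply_apply, Sum.elim_inr] at this
          simpa [dotProduct, ite_mul, Fintype.sum_ite_mem] using this
      · rintro ⟨hy0, hyK⟩ t
        rcases ht : eI.symm t with i | ⟨K, hK⟩
        · simp only [a, b, ht, Sum.elim_inl, neg_dotProduct, single_dotProduct, one_mul]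
          linarith [hy0 i]
        · simp only [a, b, ht, Sum.elim_inr]
          simpa [dotProduct, ite_mul, Fintype.sum_ite_mem] using hyK K hK
    have hrange : Set.range x = Set.range (stableSetVector (G := G)) := by
      ext y
      constructor
      · rintro ⟨t, rfl⟩; exact ⟨_, rfl⟩
      · rintro ⟨S, rfl⟩; exact ⟨eS S, by simp [x]⟩
    have hP : convexHull ℝ (Set.range x) = {y : Fin n → ℝ | ∀ t, a t ⬝ᵥ y ≤ b t} := by
      rw [hrange, hQ, ← h]; rfl
    have hxC : ∀ t, x t ∈ stabPolytope G := fun t => stableSetVector_mem_stabPolytope _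
    have hCQ : stabPolytope G ⊆ {y : Fin n → ℝ | ∀ t, a t ⬝ᵥ y ≤ b t} := by rw [hQ, ← h]
    have hbdd : Bornology.IsBounded {y : Fin n → ℝ | ∀ t, a t ⬝ᵥ y ≤ b t} := by
      rw [hQ, ← h]
      exact isBounded_convexHull.mpr (Set.finite_range _).isBounded
    have hfac := HasPsdLift.hasPsdFactorization_pairSlackMatrix hk1 hk hxC hCQ hbdd
    have hdim : Module.finrank ℝ (vectorSpan ℝ (Set.range x)) = n := by
      rw [hrange, vectorSpan_stableSetVector_eq_top, finrank_top, Module.finrank_fintype_fun_eq_card,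
        Fintype.card_fin]
    exact add_one_le_of_hasPsdFactorization_slack x a b hP hdim hn hfac

/-! ### The odd-hole obstruction matrix -/

/-- Index type of GRT's `(2m+3) × (2m+3)` matrix `S'`: rows `∅` (left unit), the singletons `{i}`
(`i ∈ V`), and `{p, r}` (right unit); columns the edge facet `x_p + x_q ≤ 1` (left unit), the
nonnegativities `x_j ≥ 0` (`j ∈ V`), and `Σ_j x_j ≤ m` (right unit). In print `V = [2m+1]`,
`p,q,r = 1,2,3`. [cite: GouveiaRobinsonThomas2013, Thm. 4.12 proof (p13–p14)] -/
abbrev OddHoleIdx (V : Type*) := Unit ⊕ V ⊕ Unit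

/-- **The matrix `S'` of GRT's proof of Theorem 4.12** (p13–p14, display quoted in the module
docstring), for a vertex type `V`, three vertices `p, q, r` (`{p,q}` the edge of the first facet,
`{p,r}` the last stable set) and the number `m` of the facet `Σx ≤ m`: the slacks of the stable sets
`∅, {i}, {p,r}` against `x_p + x_q ≤ 1`, `x_j ≥ 0`, `Σx ≤ m`.
[cite: GouveiaRobinsonThomas2013, Thm. 4.12 proof (p13–p14)] -/
def oddHoleMatrix {V : Type*} [DecidableEq V] (p q r : V) (m : ℝ) :
    Matrix (OddHoleIdx V) (OddHoleIdx V) ℝ := fun ρ c =>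
  match ρ, c with
  | Sum.inl _, Sum.inl _ => 1
  | Sum.inl _, Sum.inr (Sum.inl _) => 0
  | Sum.inl _, Sum.inr (Sum.inr _) => m
  | Sum.inr (Sum.inl i), Sum.inl _ => if i = p ∨ i = q then 0 else 1
  | Sum.inr (Sum.inl i), Sum.inr (Sum.inl j) => if i = j then 1 else 0
  | Sum.inr (Sum.inl _), Sum.inr (Sum.inr _) => m - 1
  | Sum.inr (Sum.inr _), Sum.inl _ => 0
  | Sum.inr (Sum.inr _), Sum.inr (Sum.inl j) => if j = p ∨ j = r then 1 else 0
  | Sum.inr (Sum.inr _), Sum.inr (Sum.inr _) => m - 2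

/-- The stable sets indexing the rows of `S'`, as `0/1` vectors: `∅`, `{i}`, `{p, r}`.
[cite: GouveiaRobinsonThomas2013, Thm. 4.12 proof (p13)] -/
def oddHoleRowVector {V : Type*} [DecidableEq V] (p r : V) : OddHoleIdx V → V → ℝ
  | Sum.inl _ => 0
  | Sum.inr (Sum.inl i) => fun j => if j = i then 1 else 0
  | Sum.inr (Sum.inr _) => fun j => if j = p ∨ j = r then 1 else 0

/-- The inequalities indexing the columns of `S'`, `a_cᵀx ≤ b_c`: `x_p + x_q ≤ 1`, `−x_j ≤ 0`,
`Σ_j x_j ≤ m` (normals). [cite: GouveiaRobinsonThomas2013, Thm. 4.12 proof (p13)] -/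
def oddHoleColNormal {V : Type*} [DecidableEq V] (p q : V) : OddHoleIdx V → V → ℝ
  | Sum.inl _ => fun j => (if j = p then 1 else 0) + (if j = q then 1 else 0)
  | Sum.inr (Sum.inl j) => fun i => if i = j then -1 else 0
  | Sum.inr (Sum.inr _) => fun _ => 1

/-- The inequalities indexing the columns of `S'`: right-hand sides `1, 0, m`.
[cite: GouveiaRobinsonThomas2013, Thm. 4.12 proof (p13)] -/
def oddHoleColOffset {V : Type*} (m : ℝ) : OddHoleIdx V → ℝ
  | Sum.inl _ => 1
  | Sum.inr (Sum.inl _) => 0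
  | Sum.inr (Sum.inr _) => m

/-- `S'` IS the slack matrix `(b_c − a_cᵀχ^S)` of the three kinds of stable sets against the three
kinds of inequalities (for distinct `p, q, r`). [cite: GouveiaRobinsonThomas2013, Thm. 4.12 proof (p13–p14)] -/
theorem oddHoleMatrix_eq_slack {V : Type*} [Fintype V] [DecidableEq V] {p q r : V} (hpq : p ≠ q)
    (hpr : p ≠ r) (hqr : q ≠ r) (m : ℝ) (ρ c : OddHoleIdx V) :
    oddHoleMatrix p q r m ρ c = oddHoleColOffset m c - oddHoleColNormal p q c ⬝ᵥ oddHoleRowVector p r ρ := by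
  have hsplit : ∀ k : V, (if k = p ∨ k = r then (1 : ℝ) else 0) =
      (if k = p then 1 else 0) + (if k = r then 1 else 0) := by
    intro k
    by_cases h1 : k = p
    · subst h1; simp [hpr]
    · by_cases h2 : k = r <;> simp [h1, h2, Ne.symm hpr]
  have hrow2 : oddHoleRowVector p r (Sum.inr (Sum.inr ())) =
      fun k => (if k = p then (1 : ℝ) else 0) + (if k = r then 1 else 0) := funext hsplit
  rcases ρ with _ | i | _ <;> rcases c with _ | j | _
  · simp [oddHoleMatrix, oddHoleColOffset, oddHoleRowVector]
  · simp [oddHoleMatrix, oddHoleColOffset, oddHoleRowVector]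
  · simp [oddHoleMatrix, oddHoleColOffset, oddHoleRowVector]
  · -- `({i}, edge) = 1 − [i = p] − [i = q]`
    simp only [oddHoleMatrix, oddHoleColOffset, oddHoleColNormal, oddHoleRowVector, dotProduct,
      add_mul, ite_mul, one_mul, zero_mul, Finset.sum_add_distrib, Finset.sum_ite_eq',
      Finset.mem_univ, if_true]
    by_cases hip : i = p
    · subst hip; simp [hpq, Ne.symm hpq]
    · by_cases hiq : i = q
      · subst hiq; simp [hip, hpq]
      · simp [hip, hiq, Ne.symm hip, Ne.symm hiq]
  · -- `({i}, x_j ≥ 0) = [i = j]`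
    simp only [oddHoleMatrix, oddHoleColOffset, oddHoleColNormal, oddHoleRowVector, dotProduct,
      ite_mul, neg_mul, one_mul, zero_mul, Finset.sum_ite_eq', Finset.mem_univ, if_true]
    by_cases hij : i = j
    · subst hij; simp
    · simp [hij, Ne.symm hij]
  · -- `({i}, Σ ≤ m) = m − 1`
    simp [oddHoleMatrix, oddHoleColOffset, oddHoleColNormal, oddHoleRowVector, dotProduct,
      Finset.sum_ite_eq']
  · -- `({p,r}, edge) = 0`
    simp only [oddHoleMatrix, oddHoleColOffset, oddHoleColNormal, hrow2, dotProduct, add_mul,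
      ite_mul, one_mul, zero_mul, Finset.sum_add_distrib, Finset.sum_ite_eq', Finset.mem_univ,
      if_true]
    simp [hpr, Ne.symm hpq, hqr]
  · -- `({p,r}, x_j ≥ 0) = [j ∈ {p,r}]`
    simp only [oddHoleMatrix, oddHoleColOffset, oddHoleColNormal, hrow2, dotProduct, ite_mul,
      neg_mul, one_mul, zero_mul, Finset.sum_ite_eq', Finset.mem_univ, if_true, hsplit]
    ring
  · -- `({p,r}, Σ ≤ m) = m − 2`
    simp only [oddHoleMatrix, oddHoleColOffset, oddHoleColNormal, hrow2, dotProduct, one_mul,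
      Finset.sum_add_distrib, Finset.sum_ite_eq', Finset.mem_univ, if_true]
    ring

/-! ### The computation, for a clique column (this also covers the omitted antihole case) -/

/-- GRT's computation uses, of the first column of `S'`, only that it is the slack column of an
inequality `x(K) ≤ 1` with `p ∈ K ∌ r` (there `K = {p,q}`, an edge = a maximal clique of the hole):
the **clique-column pattern** is the slack submatrix of the stable sets `∅, {i} (i ∈ V), {p,r}`
against `x(K) ≤ 1` (`K ⊆ V` any finite set), `x_j ≥ 0 (j ∈ V)` and `Σ_j x_j ≤ m`, namely
`[[1, 0,…,0, m],[1 − [i∈K], e_i, m−1]_i,[1 − [p∈K] − [r∈K], e_p + e_r, m−2]]`. For the odd ANTIHOLE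
`H̄ = C̄_{2k+1}` ("The anti-hole case is exactly analogous and is omitted here", p14) the analogous
submatrix of the slack matrix of `STAB(H̄) ⊆ {x ≥ 0 : x(K) ≤ 1 (K a clique of H̄), Σx ≤ α(H̄) = 2}`
is this pattern with `K` a maximum clique of `H̄` (a maximum stable set of the hole) through `p`
missing `r`, `{p,r}` a stable set of `H̄` (an edge of the hole) and `m = 2` (see
`not_hasHadamardSqrtOfRankLE_cliqueRankObstructionMatrix`).
[cite: GouveiaRobinsonThomas2013, Thm. 4.12 proof (p13–p14)] -/
def cliqueRankObstructionMatrix {V : Type*} [DecidableEq V] (K : Finset V) (p r : V) (m : ℝ) :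
    Matrix (OddHoleIdx V) (OddHoleIdx V) ℝ := fun ρ c =>
  match ρ, c with
  | Sum.inl _, Sum.inl _ => 1
  | Sum.inl _, Sum.inr (Sum.inl _) => 0
  | Sum.inl _, Sum.inr (Sum.inr _) => m
  | Sum.inr (Sum.inl i), Sum.inl _ => if i ∈ K then 0 else 1
  | Sum.inr (Sum.inl i), Sum.inr (Sum.inl j) => if i = j then 1 else 0
  | Sum.inr (Sum.inl _), Sum.inr (Sum.inr _) => m - 1
  | Sum.inr (Sum.inr _), Sum.inl _ => 1 - (if p ∈ K then 1 else 0) - (if r ∈ K then 1 else 0)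
  | Sum.inr (Sum.inr _), Sum.inr (Sum.inl j) => if j = p ∨ j = r then 1 else 0
  | Sum.inr (Sum.inr _), Sum.inr (Sum.inr _) => m - 2

/-- `S'` is the clique-column pattern of the edge `K = {p, q}` (for `r ∉ {p,q}`).
[cite: GouveiaRobinsonThomas2013, Thm. 4.12 proof (p13–p14)] -/
theorem oddHoleMatrix_eq_cliqueRankObstructionMatrix {V : Type*} [DecidableEq V] {p q r : V}
    (hpr : p ≠ r) (hqr : q ≠ r) (m : ℝ) :
    oddHoleMatrix p q r m = cliqueRankObstructionMatrix {p, q} p r m := by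
  ext ρ c
  rcases ρ with _ | i | _ <;> rcases c with _ | j | _ <;>
    simp [oddHoleMatrix, cliqueRankObstructionMatrix, hpr.symm, hqr.symm]

/-- The inequalities indexing the columns of the clique-column pattern, `a_cᵀx ≤ b_c`: `x(K) ≤ 1`,
`−x_j ≤ 0`, `Σ_j x_j ≤ m` (normals; offsets as in `oddHoleColOffset`).
[cite: GouveiaRobinsonThomas2013, Thm. 4.12 proof (p13)] -/
def cliqueColNormal {V : Type*} [DecidableEq V] (K : Finset V) : OddHoleIdx V → V → ℝ
  | Sum.inl _ => fun j => if j ∈ K then 1 else 0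
  | Sum.inr (Sum.inl j) => fun i => if i = j then -1 else 0
  | Sum.inr (Sum.inr _) => fun _ => 1

/-- The clique-column pattern IS the slack matrix `(b_c − a_cᵀχ^S)` of the stable sets `∅, {i},
{p,r}` (`p ≠ r`) against `x(K) ≤ 1`, `x_j ≥ 0`, `Σx ≤ m`.
[cite: GouveiaRobinsonThomas2013, Thm. 4.12 proof (p13–p14)] -/
theorem cliqueRankObstructionMatrix_eq_slack {V : Type*} [Fintype V] [DecidableEq V] (K : Finset V)
    {p r : V} (hpr : p ≠ r) (m : ℝ) (ρ c : OddHoleIdx V) :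
    cliqueRankObstructionMatrix K p r m ρ c =
      oddHoleColOffset m c - cliqueColNormal K c ⬝ᵥ oddHoleRowVector p r ρ := by
  have hsplit : ∀ k : V, (if k = p ∨ k = r then (1 : ℝ) else 0) =
      (if k = p then 1 else 0) + (if k = r then 1 else 0) := by
    intro k
    by_cases h1 : k = p
    · subst h1; simp [hpr]
    · by_cases h2 : k = r <;> simp [h1, h2, Ne.symm hpr]
  have hrow2 : oddHoleRowVector p r (Sum.inr (Sum.inr ())) =
      fun k => (if k = p then (1 : ℝ) else 0) + (if k = r then 1 else 0) := funext hsplit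
  rcases ρ with _ | i | _ <;> rcases c with _ | j | _
  · simp [cliqueRankObstructionMatrix, oddHoleColOffset, oddHoleRowVector]
  · simp [cliqueRankObstructionMatrix, oddHoleColOffset, oddHoleRowVector]
  · simp [cliqueRankObstructionMatrix, oddHoleColOffset, oddHoleRowVector]
  · -- `({i}, x(K) ≤ 1) = 1 − [i ∈ K]`
    simp only [cliqueRankObstructionMatrix, oddHoleColOffset, cliqueColNormal, oddHoleRowVector,
      dotProduct, ite_mul, one_mul, zero_mul]
    by_cases hi : i ∈ K <;> simp [hi]
  · -- `({i}, x_j ≥ 0) = [i = j]`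
    simp only [cliqueRankObstructionMatrix, oddHoleColOffset, cliqueColNormal, oddHoleRowVector,
      dotProduct, ite_mul, neg_mul, one_mul, zero_mul, Finset.sum_ite_eq', Finset.mem_univ, if_true]
    by_cases hij : i = j
    · subst hij; simp
    · simp [hij, Ne.symm hij]
  · -- `({i}, Σ ≤ m) = m − 1`
    simp [cliqueRankObstructionMatrix, oddHoleColOffset, cliqueColNormal, oddHoleRowVector, dotProduct,
      Finset.sum_ite_eq']
  · -- `({p,r}, x(K) ≤ 1) = 1 − [p ∈ K] − [r ∈ K]`
    simp only [cliqueRankObstructionMatrix, oddHoleColOffset, cliqueColNormal, hrow2, dotProduct,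
      mul_add, ite_mul, one_mul, zero_mul, Finset.sum_add_distrib]
    have h1 : (∑ k, if k ∈ K then (if k = p then (1 : ℝ) else 0) else 0) =
        if p ∈ K then 1 else 0 := by
      rw [Finset.sum_eq_single p (fun k _ hk => by simp [hk]) (by simp)]; simp
    have h2 : (∑ k, if k ∈ K then (if k = r then (1 : ℝ) else 0) else 0) =
        if r ∈ K then 1 else 0 := by
      rw [Finset.sum_eq_single r (fun k _ hk => by simp [hk]) (by simp)]; simp
    rw [h1, h2]; ring
  · -- `({p,r}, x_j ≥ 0) = [j ∈ {p,r}]`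
    simp only [cliqueRankObstructionMatrix, oddHoleColOffset, cliqueColNormal, hrow2, dotProduct,
      ite_mul, neg_mul, one_mul, zero_mul, Finset.sum_ite_eq', Finset.mem_univ, if_true, hsplit]
    ring
  · -- `({p,r}, Σ ≤ m) = m − 2`
    simp only [cliqueRankObstructionMatrix, oddHoleColOffset, cliqueColNormal, hrow2, dotProduct,
      one_mul, Finset.sum_add_distrib, Finset.sum_ite_eq', Finset.mem_univ, if_true]
    ring

/-- **The computation of GRT's proof, for the clique-column pattern** (`p ∈ K ∌ r`, `p ≠ r`, any
real `m`): EVERY real `N` with `N ∘ N =` the pattern (any signs) is nonsingular. Printed (hole case):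
"by looking at the first, second, fourth, and last columns, we see that `α₁ = ±√m, α₂ = ±√(m−1)`,
and `α₄ = ±√m ± √(m−1)`. Now by looking at the last row, we must have `±α₂ ± α₄ = ±√(m−2)`, which
is a contradiction." Here, sign-free, on a kernel vector `v`: rows `∅, {p}, {r}, {p,r}` give
`v_e² = mμ`, `v_p² = (m−1)μ` (`μ = v_Σ²`), `t := v_r² = (2m−1)μ + 2P` with `P² = m(m−1)μ²`, and
`(t + μ)² = 4(m−1)μt`; hence `t² − (4m−6)μt + μ² = 0 = t² − (4m−2)μt + μ²`, so `μt = 0`,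
`t² + μ² = 0`, `μ = t = 0`, and then every coordinate of `v` vanishes.
[cite: GouveiaRobinsonThomas2013, Thm. 4.12 proof (p14)] -/
theorem mulVec_eq_zero_of_sq_eq_cliqueRankObstructionMatrix {V : Type*} [Fintype V] [DecidableEq V]
    {K : Finset V} {p r : V} (hpK : p ∈ K) (hrK : r ∉ K) {m : ℝ}
    (N : Matrix (OddHoleIdx V) (OddHoleIdx V) ℝ)
    (hN : ∀ ρ c, N ρ c ^ 2 = cliqueRankObstructionMatrix K p r m ρ c) (v : OddHoleIdx V → ℝ)
    (hv : N *ᵥ v = 0) : v = 0 := by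
  have hpr : p ≠ r := fun h => hrK (h ▸ hpK)
  -- notation
  set e : OddHoleIdx V := Sum.inl () with he
  set σ : OddHoleIdx V := Sum.inr (Sum.inr ()) with hσ
  let X : V → OddHoleIdx V := fun j => Sum.inr (Sum.inl j)
  -- row equations
  have hrow : ∀ ρ, N ρ e * v e + ∑ j, N ρ (X j) * v (X j) + N ρ σ * v σ = 0 := by
    intro ρ
    have := congrFun hv ρ
    simpa [mulVec, dotProduct, Fintype.sum_sum_type, X, he, hσ, add_assoc] using this
  -- zero entries and squares
  have hsqv : ∀ ρ c, cliqueRankObstructionMatrix K p r m ρ c = 0 → N ρ c = 0 := fun ρ c h0 => by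
    have := hN ρ c; rw [h0] at this; exact (pow_eq_zero_iff two_ne_zero).mp this
  have z_empty : ∀ j, N e (X j) = 0 := fun j => hsqv _ _ (by simp [cliqueRankObstructionMatrix, he, X])
  have z_single : ∀ i j, j ≠ i → N (X i) (X j) = 0 := fun i j hji =>
    hsqv _ _ (by simp [cliqueRankObstructionMatrix, X, Ne.symm hji])
  have z_single_e : N (X p) e = 0 := hsqv _ _ (by simp [cliqueRankObstructionMatrix, X, he, hpK])
  have z_pair_e : N σ e = 0 := hsqv _ _ (by simp [cliqueRankObstructionMatrix, hσ, he, hpK, hrK])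
  have z_pair : ∀ j, j ≠ p → j ≠ r → N σ (X j) = 0 := fun j hjp hjr =>
    hsqv _ _ (by simp [cliqueRankObstructionMatrix, hσ, X, hjp, hjr])
  have s_ee : N e e ^ 2 = 1 := by rw [hN]; simp [cliqueRankObstructionMatrix, he]
  have s_eσ : N e σ ^ 2 = m := by rw [hN]; simp [cliqueRankObstructionMatrix, he, hσ]
  have s_pp : N (X p) (X p) ^ 2 = 1 := by rw [hN]; simp [cliqueRankObstructionMatrix, X]
  have s_pσ : N (X p) σ ^ 2 = m - 1 := by rw [hN]; simp [cliqueRankObstructionMatrix, X, hσ]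
  have s_re : N (X r) e ^ 2 = 1 := by rw [hN]; simp [cliqueRankObstructionMatrix, X, he, hrK]
  have s_rr : N (X r) (X r) ^ 2 = 1 := by rw [hN]; simp [cliqueRankObstructionMatrix, X]
  have s_rσ : N (X r) σ ^ 2 = m - 1 := by rw [hN]; simp [cliqueRankObstructionMatrix, X, hσ]
  have s_σp : N σ (X p) ^ 2 = 1 := by rw [hN]; simp [cliqueRankObstructionMatrix, X, hσ]
  have s_σr : N σ (X r) ^ 2 = 1 := by rw [hN]; simp [cliqueRankObstructionMatrix, X, hσ]
  have s_σσ : N σ σ ^ 2 = m - 2 := by rw [hN]; simp [cliqueRankObstructionMatrix, hσ]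
  have s_ii : ∀ i, N (X i) (X i) ^ 2 = 1 := fun i => by rw [hN]; simp [cliqueRankObstructionMatrix, X]
  -- the four equations
  have E0 : N e e * v e + N e σ * v σ = 0 := by
    have := hrow e
    rw [Finset.sum_eq_zero (fun j _ => by rw [z_empty j, zero_mul]), add_zero] at this
    exact this
  have Ei : ∀ i, N (X i) e * v e + N (X i) (X i) * v (X i) + N (X i) σ * v σ = 0 := by
    intro i
    have := hrow (X i)
    rw [Finset.sum_eq_single i (fun j _ hji => by rw [z_single i j hji, zero_mul]) (by simp)] at this
    exact this
  have Ep : N (X p) (X p) * v (X p) + N (X p) σ * v σ = 0 := by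
    have := Ei p; rw [z_single_e, zero_mul, zero_add] at this; exact this
  have Er := Ei r
  have Epr : N σ (X p) * v (X p) + N σ (X r) * v (X r) + N σ σ * v σ = 0 := by
    have := hrow σ
    rw [z_pair_e, zero_mul, zero_add,
      Fintype.sum_eq_add p r hpr (fun j hj => by rw [z_pair j hj.1 hj.2, zero_mul])] at this
    exact this
  -- squares: `v_e² = mμ`, `v_p² = (m−1)μ`
  have h_e : v e ^ 2 = m * v σ ^ 2 := by
    have h : (N e e * v e) ^ 2 = (N e σ * v σ) ^ 2 := by
      rw [show N e e * v e = -(N e σ * v σ) by linarith only [E0]]; ring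
    rw [mul_pow, mul_pow, s_ee, s_eσ] at h; linarith only [h]
  have h_p : v (X p) ^ 2 = (m - 1) * v σ ^ 2 := by
    have h : (N (X p) (X p) * v (X p)) ^ 2 = (N (X p) σ * v σ) ^ 2 := by
      rw [show N (X p) (X p) * v (X p) = -(N (X p) σ * v σ) by linarith only [Ep]]; ring
    rw [mul_pow, mul_pow, s_pp, s_pσ] at h; linarith only [h]
  -- `t = v_r² = (2m−1)μ + 2P`, `P² = m(m−1)μ²`
  obtain ⟨P, hP⟩ : ∃ P, P = N (X r) e * N (X r) σ * v e * v σ := ⟨_, rfl⟩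
  have hP2 : P ^ 2 = m * (m - 1) * (v σ ^ 2) ^ 2 := by
    have : P ^ 2 = N (X r) e ^ 2 * N (X r) σ ^ 2 * v e ^ 2 * v σ ^ 2 := by rw [hP]; ring
    rw [this, s_re, s_rσ, h_e]; ring
  have h_r : v (X r) ^ 2 = (2 * m - 1) * v σ ^ 2 + 2 * P := by
    have h : (N (X r) (X r) * v (X r)) ^ 2 = (N (X r) e * v e + N (X r) σ * v σ) ^ 2 := by
      rw [show N (X r) (X r) * v (X r) = -(N (X r) e * v e + N (X r) σ * v σ) by
        linarith only [Er]]; ring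
    have h' : N (X r) (X r) ^ 2 * v (X r) ^ 2 =
        N (X r) e ^ 2 * v e ^ 2 + N (X r) σ ^ 2 * v σ ^ 2 + 2 * P := by
      rw [hP]; linear_combination h
    rw [s_rr, s_re, s_rσ, h_e] at h'
    linarith only [h']
  -- `(t + μ)² = 4(m−1)μt` from the last row, `Q² = v_p² v_r²`
  obtain ⟨Q, hQ⟩ : ∃ Q, Q = N σ (X p) * N σ (X r) * v (X p) * v (X r) := ⟨_, rfl⟩
  have hQ2 : Q ^ 2 = (m - 1) * v σ ^ 2 * v (X r) ^ 2 := by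
    have : Q ^ 2 = N σ (X p) ^ 2 * N σ (X r) ^ 2 * v (X p) ^ 2 * v (X r) ^ 2 := by rw [hQ]; ring
    rw [this, s_σp, s_σr, h_p]; ring
  have h_pr : v (X r) ^ 2 + v σ ^ 2 = -(2 * Q) := by
    have h : (N σ σ * v σ) ^ 2 = (N σ (X p) * v (X p) + N σ (X r) * v (X r)) ^ 2 := by
      rw [show N σ σ * v σ = -(N σ (X p) * v (X p) + N σ (X r) * v (X r)) by
        linarith only [Epr]]; ring
    have h' : N σ σ ^ 2 * v σ ^ 2 =
        N σ (X p) ^ 2 * v (X p) ^ 2 + N σ (X r) ^ 2 * v (X r) ^ 2 + 2 * Q := by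
      rw [hQ]; linear_combination h
    rw [s_σσ, s_σp, s_σr, h_p] at h'
    linarith only [h']
  -- elimination: `μ t = 0`, then `t² + μ² = 0`
  set μ := v σ ^ 2 with hμ
  set t := v (X r) ^ 2 with ht
  have eq1 : (t + μ) ^ 2 = 4 * (m - 1) * μ * t := by
    have : (t + μ) ^ 2 = (2 * Q) ^ 2 := by rw [h_pr]; ring
    rw [this]; linear_combination 4 * hQ2
  have eq2 : (t - (2 * m - 1) * μ) ^ 2 = 4 * m * (m - 1) * μ ^ 2 := by
    have : (t - (2 * m - 1) * μ) ^ 2 = (2 * P) ^ 2 := by rw [h_r]; ring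
    rw [this]; linear_combination 4 * hP2
  have hμt : μ * t = 0 := by linear_combination (eq1 - eq2) / 4
  have hsum : t ^ 2 + μ ^ 2 = 0 := by linear_combination eq2 + (4 * m - 2) * hμt
  have hμ0 : μ = 0 := by
    have h2 : μ ^ 2 = 0 := by linarith only [hsum, sq_nonneg t, sq_nonneg μ]
    exact (pow_eq_zero_iff two_ne_zero).mp h2
  have ht0 : t = 0 := by
    have h2 : t ^ 2 = 0 := by linarith only [hsum, sq_nonneg t, sq_nonneg μ]
    exact (pow_eq_zero_iff two_ne_zero).mp h2
  have hvσ : v σ = 0 := (pow_eq_zero_iff two_ne_zero).mp (hμ ▸ hμ0)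
  have hvr : v (X r) = 0 := (pow_eq_zero_iff two_ne_zero).mp (ht ▸ ht0)
  have hve : v e = 0 := (pow_eq_zero_iff two_ne_zero).mp (by rw [h_e, hμ0, mul_zero])
  have hvi : ∀ i, v (X i) = 0 := by
    intro i
    have h := Ei i
    simp only [hve, hvσ, mul_zero, zero_add, add_zero] at h
    rcases mul_eq_zero.mp h with h0 | h0
    · exfalso; have := s_ii i; rw [h0] at this; norm_num at this
    · exact h0
  funext ρ
  rcases ρ with _ | i | _
  · exact hve
  · exact hvi i
  · exact hvσ

/-- **"`rank_√ S' > 2m+2`"** (p14), in the strong form: for `r ∉ {p, q}` and EVERY real `N`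
with `N ∘ N = S'` (any signs), `N` is nonsingular — its kernel is trivial. Printed: "by looking at the
first, second, fourth, and last columns, we see that `α₁ = ±√m, α₂ = ±√(m−1)`, and
`α₄ = ±√m ± √(m−1)`. Now by looking at the last row, we must have `±α₂ ± α₄ = ±√(m−2)`, which is a
contradiction." (The computation is `mulVec_eq_zero_of_sq_eq_cliqueRankObstructionMatrix` with `K = {p,q}`; sign-free, on a kernel vector `v`: rows `∅, {p}, {r}, {p,r}` give
`v_e² = mμ`, `v_p² = (m−1)μ` (`μ = v_Σ²`), `t := v_r² = (2m−1)μ + 2P` with `P² = m(m−1)μ²`, and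
`(t + μ)² = 4(m−1)μt`; hence `t² − (4m−6)μt + μ² = 0 = t² − (4m−2)μt + μ²`, so `μt = 0`,
`t² + μ² = 0`, `μ = t = 0`, and then every coordinate of `v` vanishes.)
[cite: GouveiaRobinsonThomas2013, Thm. 4.12 proof (p14)] -/
theorem mulVec_eq_zero_of_sq_eq_oddHoleMatrix {V : Type*} [Fintype V] [DecidableEq V] {p q r : V}
    (hpr : p ≠ r) (hqr : q ≠ r) {m : ℝ} (N : Matrix (OddHoleIdx V) (OddHoleIdx V) ℝ)
    (hN : ∀ ρ c, N ρ c ^ 2 = oddHoleMatrix p q r m ρ c) (v : OddHoleIdx V → ℝ) (hv : N *ᵥ v = 0) :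
    v = 0 := by
  rw [oddHoleMatrix_eq_cliqueRankObstructionMatrix hpr hqr] at hN
  exact mulVec_eq_zero_of_sq_eq_cliqueRankObstructionMatrix (K := {p, q}) (by simp)
    (by simp [Ne.symm hpr, Ne.symm hqr]) N hN v hv

/-- Hence every Hadamard square root of `S'` has full rank `|V| + 2` (printed: `2m + 3 > 2m + 2`).
[cite: GouveiaRobinsonThomas2013, Thm. 4.12 proof (p14: "Hence, `rank_√ S' > 2m+2`")] -/
theorem rank_eq_of_sq_eq_oddHoleMatrix {V : Type*} [Fintype V] [DecidableEq V] {p q r : V}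
    (hpr : p ≠ r) (hqr : q ≠ r) {m : ℝ} (N : Matrix (OddHoleIdx V) (OddHoleIdx V) ℝ)
    (hN : ∀ ρ c, N ρ c ^ 2 = oddHoleMatrix p q r m ρ c) :
    N.rank = Fintype.card V + 2 := by
  have hinj : Function.Injective N.mulVecLin :=
    (injective_iff_map_eq_zero N.mulVecLin).mpr fun v hv =>
      mulVec_eq_zero_of_sq_eq_oddHoleMatrix hpr hqr N hN v (by simpa using hv)
  rw [Matrix.rank, LinearMap.finrank_range_of_inj hinj, Module.finrank_fintype_fun_eq_card]
  simp [Fintype.card_sum]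
  ring

/-- In the tree's vocabulary: `S'` has NO Hadamard square root of rank `≤ |V| + 1` (`= 2m + 2` for
the odd hole `C_{2m+1}`), so — since a psd-minimal `(2m+1)`-polytope would have `rank_√` of its slack
matrix equal to `2m+2` (GRT Thm 3.5) — "`STAB(H)` is not of minimal psd rank".
[cite: GouveiaRobinsonThomas2013, Thm. 4.12 proof (p14)] -/
theorem not_hasHadamardSqrtOfRankLE_oddHoleMatrix {V : Type*} [Fintype V] [DecidableEq V] {p q r : V}
    (hpr : p ≠ r) (hqr : q ≠ r) (m : ℝ) :
    ¬ HasHadamardSqrtOfRankLE (oddHoleMatrix p q r m) (Fintype.card V + 1) := by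
  rintro ⟨N, hN, hrk⟩
  have := rank_eq_of_sq_eq_oddHoleMatrix hpr hqr N hN
  omega

/-! ### Nonsingularity for the clique-column pattern: the antihole case -/

/-- Every Hadamard square root of the clique-column pattern (`p ∈ K ∌ r`, any real `m`) has full
rank `|V| + 2`. [cite: GouveiaRobinsonThomas2013, Thm. 4.12 proof (p14)] -/
theorem rank_eq_of_sq_eq_cliqueRankObstructionMatrix {V : Type*} [Fintype V] [DecidableEq V]
    {K : Finset V} {p r : V} (hpK : p ∈ K) (hrK : r ∉ K) {m : ℝ}
    (N : Matrix (OddHoleIdx V) (OddHoleIdx V) ℝ)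
    (hN : ∀ ρ c, N ρ c ^ 2 = cliqueRankObstructionMatrix K p r m ρ c) :
    N.rank = Fintype.card V + 2 := by
  have hinj : Function.Injective N.mulVecLin :=
    (injective_iff_map_eq_zero N.mulVecLin).mpr fun v hv =>
      mulVec_eq_zero_of_sq_eq_cliqueRankObstructionMatrix hpK hrK N hN v (by simpa using hv)
  rw [Matrix.rank, LinearMap.finrank_range_of_inj hinj, Module.finrank_fintype_fun_eq_card]
  simp [Fintype.card_sum]
  ring

/-- **The omitted antihole case of GRT Theorem 4.12, as its matrix computation** ("The anti-hole case
is exactly analogous and is omitted here", p14): the clique-column pattern with `p ∈ K ∌ r` has NO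
Hadamard square root of rank `≤ |V| + 1`, for every real `m` — for the odd hole `H = C_{2m+1}` this is
`S'` (`K = {p,q}` an edge, `not_hasHadamardSqrtOfRankLE_oddHoleMatrix`), and for the odd antihole
`H̄ = C̄_{2k+1}` (`|V| = 2k+1`, `K` a maximum clique of `H̄` through `p` missing `r`, `{p,r}` a stable
set of `H̄`, last column `Σx ≤ α(H̄) = 2`, i.e. `m = 2`) it is the analogous `(2k+3) × (2k+3)`
submatrix of the slack matrix of `STAB(H̄)`, whose `rank_√` therefore exceeds `2k+2 = dim STAB(H̄) + 1`:
"`STAB(H)` is not of minimal psd rank" in both cases (GRT Thm. 3.5). The graph-theoretic framing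
(that these ARE stable sets / valid inequalities of the antihole) is not typed here.
[cite: GouveiaRobinsonThomas2013, Thm. 4.12 proof (p14)] -/
theorem not_hasHadamardSqrtOfRankLE_cliqueRankObstructionMatrix {V : Type*} [Fintype V]
    [DecidableEq V] {K : Finset V} {p r : V} (hpK : p ∈ K) (hrK : r ∉ K) (m : ℝ) :
    ¬ HasHadamardSqrtOfRankLE (cliqueRankObstructionMatrix K p r m) (Fintype.card V + 1) := by
  rintro ⟨N, hN, hrk⟩
  have := rank_eq_of_sq_eq_cliqueRankObstructionMatrix hpK hrK N hN
  omega

end Literature.Combinatorics.Optimization
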